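import Mathlib.AlgebraicGeometry.AlgClosed.Basic
import Mathlib.Analysis.Complex.Polynomial.Basic
import Mathlib.Topology.JacobsonSpace
import Literature.AlgebraicGeometry.Motives.AtypicalHodgeLocus
import HarnessLib

/-!
# Route PeriodDeficiency — `QbarGenericIsHodgeGeneric` (stmt-HodgeConjecture-11595), line `registered`, reshape r5 (lead c2): stub (iv'-b2) `stub_irreducible_subset_of_cover`

**Statement.** Assume countable prime avoidance in finitely generated `ℂ`-algebras (stub (iv'-b1),
taken here as a hypothesis): for `A` of finite type over `ℂ`, a prime `𝔭` and ideals `I k ⊄ 𝔭`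
(`k ∈ ℕ`), some maximal ideal contains `𝔭` and no `I k`. Then for a `ℂ`-scheme `S` locally of
finite type, an affine open `U ⊆ S`, an irreducible Zariski-closed set `Y ⊆ S(ℂ)` of complex points
meeting `U(ℂ)` (`IsIrreducibleZariskiClosedOnPoints`: closed and irreducible for the topology on
`S(ℂ)` induced from `S` along `P ↦ P.pt`) and Zariski-closed sets `W k ⊆ S(ℂ)` (`k ∈ ℕ`) which
together contain every point of `Y` lying over `U`, some `W k` contains `Y`.

**Proof.** Write `Y = pt⁻¹(C)`, `W k = pt⁻¹(C_k)` with `C, C_k ⊆ S` closed. The closure `T` of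
`pt(Y)` is an irreducible closed subset of `S` with `Y = pt⁻¹(T)`; let `η` be its generic point
(schemes are sober). A point `y ∈ Y` over `U` gives `η ⤳ pt y ∈ U`, so `η ∈ U`. If no `W k`
contains `Y` then `η ∉ C_k` for all `k`. In `U = Spec R`, `R = Γ(S, U)` a finitely generated
`ℂ`-algebra, let `𝔭` be the prime of `η` and `I k` the vanishing ideal of the closed set
`C_k ∩ U ⊆ Spec R`; then `I k ⊄ 𝔭`. The hypothesis gives a maximal `𝔪 ⊇ 𝔭` containing no `I k`,
i.e. a closed point `x'` of `Spec R` in the closure of `𝔭` and in no `C_k`. By the Nullstellensatz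
(Mathlib `AlgebraicGeometry.pointOfClosedPoint`, for the locally-of-finite-type `ℂ`-scheme
`Spec R → U ⊆ S → Spec ℂ`) `x'` is the image of a `ℂ`-point `P` of `S` with `pt P = x' ∈ U ∩ T`, so
`P ∈ Y` lies over `U` but in no `W k` — a contradiction.

Everything used is proved in Mathlib or is definitional in the tree; the only non-Mathlib input is
the hypothesis (iv'-b1).

## References

* R. Hartshorne, *Algebraic Geometry*, II Ex. 3.14 (closed points of a variety are dense), I.1
  (Hilbert's Nullstellensatz).
* G. Baldi, B. Klingler, E. Ullmo, On the distribution of the Hodge locus, Invent. Math. 235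
  (2024), §3.1 ("a complex algebraic variety is not a countable union of strict closed
  subvarieties"). [BaldiKlinglerUllmo2024]
-/

noncomputable section

-- every declaration of this problem lives in `Summit.HodgeConjecture.HodgeConjecture.…` (summit = sub-problem)
set_option linter.dupNamespace false

open CategoryTheory AlgebraicGeometry Literature.AlgebraicGeometry.Motives
open Topology

namespace Summit.HodgeConjecture.HodgeConjecture.Theorems

/-- **STUB (iv'-b2) of the line `registered` (reshape r5) of the crux `QbarGenericIsHodgeGeneric` —
an irreducible closed set of complex points is not covered, on an affine chart, by countably many
Zariski-closed sets missing it** (given countable prime avoidance (iv'-b1) as a hypothesis): for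
`S` locally of finite type over `ℂ`, `U ⊆ S` affine open, `Y ⊆ S(ℂ)` irreducible Zariski-closed
meeting `U(ℂ)` and Zariski-closed `W k` (`k ∈ ℕ`) containing every point of `Y` over `U`, some
`W k` contains `Y`. Proof: the generic point `η` of the closed irreducible subset of `S` underlying
`Y` lies in `U = Spec Γ(S, U)`; if no `W k ⊇ Y`, the vanishing ideals of the `W k ∩ U` are not
below `𝔭_η`; the hypothesis gives a closed point of `U` specialising `η` off every `W k`, which is
(the underlying point of) a complex point of `Y` over `U` (Nullstellensatz, Mathlib
`pointOfClosedPoint`) lying in no `W k`. [folklore] -/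
theorem stub_irreducible_subset_of_cover :
    (∀ (A : Type) [CommRing A] [Algebra ℂ A] [Algebra.FiniteType ℂ A] (𝔭 : Ideal A) [𝔭.IsPrime]
      (I : ℕ → Ideal A), (∀ k, ¬ I k ≤ 𝔭) →
      ∃ 𝔪 : Ideal A, 𝔪.IsMaximal ∧ 𝔭 ≤ 𝔪 ∧ ∀ k, ¬ I k ≤ 𝔪) →
    ∀ ⦃S : SchemeOver ℂ⦄, LocallyOfFiniteType S.hom → ∀ (U : S.left.Opens), IsAffineOpen U →
      ∀ Y : Set (ComplexPoints S), IsIrreducibleZariskiClosedOnPoints S Y → (∃ y ∈ Y, y.pt ∈ U) →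
      ∀ W : ℕ → Set (ComplexPoints S), (∀ k, IsZariskiClosedOnPoints S (W k)) →
        (∀ y ∈ Y, y.pt ∈ U → ∃ k, y ∈ W k) → ∃ k, Y ⊆ W k := by
  intro havoid S hS U hU Y hY hYU W hW hcov
  haveI := hS
  -- closed subsets of `S` cutting out `Y` and the `W k` on complex points
  obtain ⟨C, hC, hCY⟩ := isClosed_induced_iff.mp hY.1
  choose D hD hDW using hW
  -- the irreducible closed subset `T = closure (pt '' Y)` of `S` and its generic point `η`
  set f : ZariskiPoints S ℂ → S.left := fun P => P.val.pt
  have hf : Continuous f := continuous_induced_dom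
  have hT₀ : IsIrreducible (f '' zariskiSet S Y) := hY.2.image f hf.continuousOn
  set η : S.left := hT₀.genericPoint
  have hη : IsGenericPoint η (closure (f '' zariskiSet S Y)) :=
    hT₀.isGenericPoint_genericPoint_closure
  -- `Y = pt⁻¹(T)`
  have hTC : closure (f '' zariskiSet S Y) ⊆ C := by
    refine closure_minimal ?_ hC
    rintro _ ⟨Q, hQ, rfl⟩
    rw [← hCY] at hQ
    exact hQ
  have hYT : ∀ P : ComplexPoints S, P.pt ∈ closure (f '' zariskiSet S Y) → P ∈ Y := by
    intro P hP
    have hP' : (show ZariskiPoints S ℂ from P) ∈ f ⁻¹' C := hTC hP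
    rw [hCY] at hP'
    exact hP'
  have hTY : ∀ P ∈ Y, P.pt ∈ closure (f '' zariskiSet S Y) := fun P hP =>
    subset_closure ⟨(show ZariskiPoints S ℂ from P), hP, rfl⟩
  -- `η ∈ U`, since `η` specialises to a point of `Y` over `U` and `U` is open
  have hηU : η ∈ U := by
    obtain ⟨y, hy, hyU⟩ := hYU
    exact (hη.specializes (hTY y hy)).mem_open U.isOpen hyU
  by_contra hnot
  push Not at hnot
  -- no `C_k` contains `η`
  have hηD : ∀ k, η ∉ D k := by
    intro k hk
    apply hnot k
    intro P hP
    rw [hDW k]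
    exact (hη.mem_closed_set_iff (hD k)).mp hk (hTY P hP)
  -- `R = Γ(S, U)` is a finitely generated `ℂ`-algebra
  letI alg : Algebra ℂ Γ(S.left, U) :=
    ((S.hom.appLE ⊤ U le_top).hom.comp (Scheme.ΓSpecIso (.of ℂ)).inv.hom).toAlgebra
  haveI : Algebra.FiniteType ℂ Γ(S.left, U) := by
    have h1 : (S.hom.appLE ⊤ U le_top).hom.FiniteType :=
      S.hom.finiteType_appLE (isAffineOpen_top _) hU le_top
    have h2 : (Scheme.ΓSpecIso (.of ℂ)).inv.hom.FiniteType :=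
      RingHom.FiniteType.of_surjective _
        (Scheme.ΓSpecIso (.of ℂ)).symm.commRingCatIsoToRingEquiv.surjective
    exact h1.comp h2
  -- the prime `𝔭 = x₀` of `η` and the closed sets `Z k = C_k ∩ U` of `Spec R`
  set x₀ : PrimeSpectrum Γ(S.left, U) := hU.primeIdealOf ⟨η, hηU⟩
  have hx₀η : hU.fromSpec x₀ = η := hU.fromSpec_primeIdealOf ⟨η, hηU⟩
  set Z : ℕ → Set (PrimeSpectrum Γ(S.left, U)) := fun k => hU.fromSpec ⁻¹' D k
  have hZ : ∀ k, IsClosed (Z k) := fun k => (hD k).preimage hU.fromSpec.continuous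
  have hmemZ : ∀ k (x : PrimeSpectrum Γ(S.left, U)),
      x ∈ Z k ↔ PrimeSpectrum.vanishingIdeal (Z k) ≤ x.asIdeal := by
    intro k x
    rw [← SetLike.coe_subset_coe, ← PrimeSpectrum.mem_zeroLocus,
      PrimeSpectrum.zeroLocus_vanishingIdeal_eq_closure, (hZ k).closure_eq]
  have hI : ∀ k, ¬ PrimeSpectrum.vanishingIdeal (Z k) ≤ x₀.asIdeal := by
    intro k hk
    rw [← hmemZ] at hk
    apply hηD k
    rw [← hx₀η]
    exact hk
  -- countable prime avoidance: a maximal `𝔪 ⊇ 𝔭` containing no `I k`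
  obtain ⟨𝔪, h𝔪, hx₀𝔪, h𝔪I⟩ :=
    havoid Γ(S.left, U) x₀.asIdeal (fun k => PrimeSpectrum.vanishingIdeal (Z k)) hI
  -- the closed point `x'` of `Spec R`, a specialisation of `x₀`
  set x' : PrimeSpectrum Γ(S.left, U) := ⟨𝔪, h𝔪.isPrime⟩
  have hx' : IsClosed ({x'} : Set (PrimeSpectrum Γ(S.left, U))) :=
    (PrimeSpectrum.isClosed_singleton_iff_isMaximal x').mpr h𝔪
  have hspec : x₀ ⤳ x' := (PrimeSpectrum.le_iff_specializes x₀ x').mp hx₀𝔪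
  -- the complex point of `S` through `x'` (Nullstellensatz)
  set p : Spec (.of ℂ) ⟶ Spec Γ(S.left, U) := pointOfClosedPoint (hU.fromSpec ≫ S.hom) x' hx'
    with hp_def
  set P : ComplexPoints S := AlgPoints.mk (p ≫ hU.fromSpec) (by
    rw [Category.assoc, hp_def, pointOfClosedPoint_comp, Algebra.algebraMap_self,
      CommRingCat.ofHom_id, Spec.map_id])
  have hPpt : P.pt = hU.fromSpec x' := by
    change (p ≫ hU.fromSpec) (IsLocalRing.closedPoint ℂ) = _
    rw [Scheme.Hom.comp_apply, hp_def, pointOfClosedPoint_apply]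
  have hPU : P.pt ∈ U := by
    rw [hPpt, ← SetLike.mem_coe, ← hU.range_fromSpec]
    exact Set.mem_range_self x'
  -- `P ∈ Y`: `pt P = x'` lies in the closure `T` of `η = x₀`
  have hPY : P ∈ Y := by
    apply hYT
    rw [← hη.def, hPpt, ← hx₀η]
    exact specializes_iff_mem_closure.mp (hspec.map hU.fromSpec.continuous)
  -- hence `P ∈ W k` for some `k`, i.e. `x' ∈ Z k`, i.e. `I k ≤ 𝔪`: contradiction
  obtain ⟨k, hk⟩ := hcov P hPY hPU
  rw [hDW k] at hk
  apply h𝔪I k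
  change PrimeSpectrum.vanishingIdeal (Z k) ≤ x'.asIdeal
  rw [← hmemZ]
  change hU.fromSpec x' ∈ D k
  rw [← hPpt]
  exact hk

end Summit.HodgeConjecture.HodgeConjecture.Theorems
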